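import Mathlib

/-!
# Test planes of `2 × 2` matrices and polynomial preimages (helpers for `TwoByTwoHostingEight`)

Route FieldSumsetRank, item stmt-MatrixMultiplication-8741 (`TwoByTwoHostingEight`). For
`ξ_j = (1, j)` and `ξ_j^⊥ = (j, -1)` (`j < 8`) the rank-one matrices `x ξ_jᵀ` and `ξ_j^⊥ ηᵀ`
multiply to zero; the planes `ℂ² ξ_jᵀ ⊆ M₂(ℂ)` are pairwise complementary. The maps
`x ↦ x ξᵀ`, `η ↦ y ηᵀ` are packaged as linear maps through existence statements (no definitions
are declared). Also: elements of a progression `⟨1, a, …, a^{n-1}⟩` are values at `a` of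
polynomials of degree `< n`.
-/

set_option linter.dupNamespace false

noncomputable section

open Module Polynomial

namespace Summit.MatrixMultiplication.MatrixMultiplication.Theorems

namespace TwoByTwoHosting

/-! ### The test matrices `x ξⱼᵀ` and `ξⱼ^⊥ ηᵀ` (`ξⱼ = (1, j)`, `ξⱼ^⊥ = (j, -1)`) -/

/-- A linear-map packaging of `x ↦ x ξᵀ`. -/
theorem exists_rowMap : ∃ row : (Fin 2 → ℂ) → (Fin 2 → ℂ) →ₗ[ℂ] Matrix (Fin 2) (Fin 2) ℂ,
    ∀ ξ x i k, row ξ x i k = x i * ξ k :=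
  ⟨fun ξ =>
    { toFun := fun x => Matrix.vecMulVec x ξ
      map_add' := fun x y => by
        ext i k
        simp [Matrix.vecMulVec_apply, add_mul]
      map_smul' := fun c x => by
        ext i k
        simp [Matrix.vecMulVec_apply, mul_assoc] },
    fun _ _ _ _ => rfl⟩

/-- A linear-map packaging of `η ↦ y ηᵀ`. -/
theorem exists_colMap : ∃ col : (Fin 2 → ℂ) → (Fin 2 → ℂ) →ₗ[ℂ] Matrix (Fin 2) (Fin 2) ℂ,
    ∀ y η i k, col y η i k = y i * η k :=
  ⟨fun y =>
    { toFun := fun η => Matrix.vecMulVec y η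
      map_add' := fun η η' => by
        ext i k
        simp [Matrix.vecMulVec_apply, mul_add]
      map_smul' := fun c η => by
        ext i k
        simp [Matrix.vecMulVec_apply, mul_left_comm] },
    fun _ _ _ _ => rfl⟩

section RowCol

variable (row col : (Fin 2 → ℂ) → (Fin 2 → ℂ) →ₗ[ℂ] Matrix (Fin 2) (Fin 2) ℂ)

/-- `(x ξ_jᵀ)(ξ_j^⊥ ηᵀ) = 0`. -/
theorem rowMap_mul_colMap (hrow : ∀ ξ x i k, row ξ x i k = x i * ξ k)
    (hcol : ∀ y η i k, col y η i k = y i * η k) (j : Fin 8) (x η : Fin 2 → ℂ) :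
    row ![1, (j : ℂ)] x * col ![(j : ℂ), -1] η = 0 := by
  ext i k
  simp [Matrix.mul_apply, Fin.sum_univ_two, hrow, hcol]
  ring

/-- `x ↦ x ξ_jᵀ` is injective. -/
theorem rowMap_injective (hrow : ∀ ξ x i k, row ξ x i k = x i * ξ k) (j : Fin 8) :
    Function.Injective (row ![1, (j : ℂ)]) := by
  intro x y h
  ext i
  have := congrFun (congrFun h i) 0
  simpa [hrow] using this

/-- `η ↦ ξ_j^⊥ ηᵀ` is injective. -/
theorem colMap_injective (hcol : ∀ y η i k, col y η i k = y i * η k) (j : Fin 8) :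
    Function.Injective (col ![(j : ℂ), -1]) := by
  intro x y h
  ext k
  have := congrFun (congrFun h 1) k
  simpa [hcol] using this

/-- For `j ≠ j'` the planes `ℂ² ξ_jᵀ`, `ℂ² ξ_j'ᵀ` meet trivially. -/
theorem range_rowMap_inf (hrow : ∀ ξ x i k, row ξ x i k = x i * ξ k) (j j' : Fin 8)
    (hjj' : j ≠ j') :
    LinearMap.range (row ![1, (j : ℂ)]) ⊓ LinearMap.range (row ![1, (j' : ℂ)]) = ⊥ := by
  rw [eq_bot_iff]
  intro X hX
  obtain ⟨⟨x, hx⟩, ⟨y, hy⟩⟩ := Submodule.mem_inf.mp hX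
  rw [Submodule.mem_bot, ← hx]
  have h0 : ∀ i, x i = y i := fun i => by
    have := congrFun (congrFun (hx.trans hy.symm) i) 0
    simpa [hrow] using this
  have h1 : ∀ i, x i * (j : ℂ) = y i * (j' : ℂ) := fun i => by
    have := congrFun (congrFun (hx.trans hy.symm) i) 1
    simpa [hrow] using this
  have hne : (j : ℂ) ≠ (j' : ℂ) := by
    norm_cast
    exact fun h => hjj' (Fin.ext h)
  have hx0 : x = 0 := by
    ext i
    have h2 : x i * ((j : ℂ) - j') = 0 := by rw [mul_sub, h1 i, h0 i, sub_self]
    simpa [sub_eq_zero, hne] using h2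
  simp [hx0]

/-- For `j ≠ j'` the planes `ℂ² ξ_jᵀ`, `ℂ² ξ_j'ᵀ` span all matrices. -/
theorem range_rowMap_sup (hrow : ∀ ξ x i k, row ξ x i k = x i * ξ k) (j j' : Fin 8)
    (hjj' : j ≠ j') :
    LinearMap.range (row ![1, (j : ℂ)]) ⊔ LinearMap.range (row ![1, (j' : ℂ)]) = ⊤ := by
  apply Submodule.eq_top_of_finrank_eq
  have h := Submodule.finrank_sup_add_finrank_inf_eq (LinearMap.range (row ![1, (j : ℂ)]))
    (LinearMap.range (row ![1, (j' : ℂ)]))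
  rw [range_rowMap_inf row hrow j j' hjj', finrank_bot,
    LinearMap.finrank_range_of_inj (rowMap_injective row hrow j),
    LinearMap.finrank_range_of_inj (rowMap_injective row hrow j')] at h
  simp only [finrank_fin_fun, add_zero] at h
  rw [h, Module.finrank_matrix]
  simp

end RowCol

variable {L : Type} [Field L] [Algebra ℂ L]

/-- Elements of `⟨1, a, …, a^{n-1}⟩` are values at `a` of polynomials of degree `< n`. -/
theorem exists_poly_of_mem_prog {a : L} {n : ℕ} {z : L}
    (hz : z ∈ Submodule.span ℂ (Set.range fun i : Fin n => a ^ (i : ℕ))) :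
    ∃ p : ℂ[X], p.degree < n ∧ aeval a p = z := by
  refine Submodule.span_induction (p := fun z _ => ∃ p : ℂ[X], p.degree < n ∧ aeval a p = z)
    ?_ ⟨0, by simp, by simp⟩ ?_ ?_ hz
  · rintro _ ⟨i, rfl⟩
    refine ⟨X ^ (i : ℕ), ?_, by simp⟩
    rw [degree_X_pow]
    exact_mod_cast i.2
  · rintro x y - - ⟨p, hp, rfl⟩ ⟨q, hq, rfl⟩
    exact ⟨p + q, (degree_add_le p q).trans_lt (max_lt hp hq), by simp⟩
  · rintro c x - ⟨p, hp, rfl⟩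
    refine ⟨c • p, (degree_smul_le c p).trans_lt hp, by simp⟩

end TwoByTwoHosting

end Summit.MatrixMultiplication.MatrixMultiplication.Theorems
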